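import Mathlib
import Summits.ValiantsHypothesis.ValiantsHypothesis.Theorems.BarrierLeverPartitionMinorsHitByVPHiddenStatesSymbolicStep
import Summits.ValiantsHypothesis.ValiantsHypothesis.Theorems.BarrierLeverPartitionMinorsHitByVPHiddenStatesAffineCut

/-!
# Route BarrierLever — item `PartitionMinorsHitByVP` (stmt-ValiantsHypothesis-19717), line `hidden-states`:
# THE COMBINATORIAL SPLIT STEP — a `Fit` node from an affinely closed column set, no numeric cut constants

Helper file (`--supports stmt-ValiantsHypothesis-19717`; cell valiant-natproofs, rung V4, 𝒟-side door (c), registered line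
`Cruxes/PartitionMinorsHitByVP/Lines/hidden_states.lean`, lane `stub_universalJoinWide` / `stub_fit`; prover seat val-np-p6 gen 8).
No definitions. Closes NO item.

THE POINT. `SymbJoin.symGood_of_split_enum` (val-np-p3 g10) turns one node of a cut-tree certificate into generic goodness, given numeric
cut constants `β, γ` with the right zero pattern. Composing it with the affine-closure cut lemma (`exists_cut_of_affClosed`, p591478) gives
the CONSTANT-FREE node `symGood_of_affSplit`: the data are a coordinate `x`, enumerations of deletion/link rows and of the two column classes,
and the purely combinatorial hypothesis that no column of the link class has its affine row vector `(1, 1_J)` in the span of the affine row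
vectors of the deletion-class columns of the same piece. Together with the free-parts leaf (`symGood_of_affFree`, p589275) a certificate is a
finite combinatorial object: (coordinate, affinely closed sub-families with the right counts) at each node, «all parts affinely independent»
or «≤ 1 row» at each leaf — exactly what the census solver of memo val-np-p6 g8 searches for.

WHAT THIS IS NOT: no family is certified here; item 19717 OPEN; nothing on crux 14610 or VP ≠ VNP.
-/

set_option linter.dupNamespace false

namespace Summit.ValiantsHypothesis.ValiantsHypothesis.Theorems.BarrierLever.HiddenStates

open Finset Matrix MvPolynomial

noncomputable section

namespace SymbJoin

variable {h m K r r₀ r₁ : ℕ}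

/-- **Combinatorial split step.** As `symGood_of_split_enum`, but instead of cut constants the hypothesis is AFFINE CLOSURE of the
deletion-class columns inside each piece: for every column `k` outside the deletion class `g₀`, the affine row vector of `k` is not in the
span of the affine row vectors of the deletion-class columns of `k`'s piece. -/
theorem symGood_of_affSplit (u : Fin r → Finset (Fin h)) (e : Fin r → Fin m × Finset (Fin K)) (x : Fin h) (hr : r₀ + r₁ = r)
    (f₀ : Fin r₀ → Fin r) (f₁ : Fin r₁ → Fin r) (g₀ : Fin r₀ → Fin r) (g₁ : Fin r₁ → Fin r)
    (hf : Function.Injective (Sum.elim f₀ f₁)) (hg : Function.Injective (Sum.elim g₀ g₁))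
    (hrow0 : ∀ j, x ∉ u (f₀ j)) (hrow1 : ∀ j, x ∈ u (f₁ j))
    (haff : ∀ k, k ∉ Finset.univ.image g₀ →
      (fun o : Option (Fin K) => Option.elim o (1 : ℂ) fun q => if q ∈ (e k).2 then 1 else 0) ∉
        Submodule.span ℂ ((fun k' => fun o : Option (Fin K) => Option.elim o (1 : ℂ) fun q => if q ∈ (e k').2 then 1 else 0) ''
          {k' | k' ∈ Finset.univ.image g₀ ∧ (e k').1 = (e k).1}))
    (h0 : symDet (fun j : Fin r₀ => u (f₀ j)) (fun j => e (g₀ j)) ≠ 0)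
    (h1 : symDet (fun j : Fin r₁ => (u (f₁ j)).erase x) (fun j => e (g₁ j)) ≠ 0) :
    symDet u e ≠ 0 := by
  classical
  obtain ⟨β, γ, hcut⟩ := exists_cut_of_affClosed e (Finset.univ.image g₀) haff
  refine symGood_of_split_enum u e x β γ hr f₀ f₁ g₀ g₁ hf hg hrow0 hrow1 ?_ ?_ h0 h1
  · intro j
    exact (hcut (g₀ j)).mpr (Finset.mem_image_of_mem g₀ (Finset.mem_univ j))
  · intro j hzero
    have hmem := (hcut (g₁ j)).mp hzero
    rw [Finset.mem_image] at hmem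
    obtain ⟨j₀, _, hj₀⟩ := hmem
    have : Sum.elim g₀ g₁ (Sum.inl j₀) = Sum.elim g₀ g₁ (Sum.inr j) := by simpa using hj₀
    exact Sum.inl_ne_inr (hg this)

end SymbJoin

end

end Summit.ValiantsHypothesis.ValiantsHypothesis.Theorems.BarrierLever.HiddenStates
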